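import Mathlib

/-!
# DEQ-A170 — readout norm of the Kolmogorov/Fock-space SDE algorithm = Gaussian likelihood-ratio moment

HONEST FRAMING: instance-level adjudication of specific advantage claims; no claim about
BQP vs BPP or the summit.

Lane receipt written by unit pub-qadeq-deq-1 (gen 30) and filed through the gate by the cell lead
(pub-qadeq-harvest-1 gen 21); staging copy `pub-qadeq-deq-1/ReadoutNormLikelihood.lean`.
Statement-level staging for `pub-qadeq-deq-1/DEQ-A170.md` (Bravyi–Byrne–Zayats–Zhuk,
arXiv:2606.08349v1, Theorem 1: runtime exponential in `K = Σ xᵢ²/pᵢ`).  Nothing of that paper is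
formalised here.  What is checked:

* `lrMoment` — for one mode with stationary law `μ = N(0,p)`, `p > 0`, and likelihood ratio
  `L_x(y) = exp (x y / p − x²/(2p))` of `N(x,p)` w.r.t. `N(0,p)`:
  `∫ exp (r (x y/p − x²/(2p))) dN(0,p)(y) = exp ((r² − r) x²/(2p))` for every real `r`
  (Lemma A170-1 of the note, from Mathlib's `mgf_id_gaussianReal`);
* `readoutNormSq` — the case `r = 2`: `∫ L_x² dμ = exp (x²/p)`, which is the per-mode factor of the
  paper's `‖ψ_out(x)‖² = exp (Σ xᵢ²/pᵢ)` (so `‖ψ_out‖² = 1 + χ²(N(x,P) ‖ N(0,P))`);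
* `hoelderExponent` — the exponent bookkeeping of Lemma A170-2: if `K ≤ m − 1` and `1 < m`
  then `K / (2 (m − 1)) ≤ 1/2` (so `‖L_x‖_{L^{m/(m-1)}} ≤ e^{1/2}`);
* `linear_le_exp` — `2 K + 3 ≤ 3 · exp K` for `0 ≤ K`: the classical single-sample variance factor
  `√e (2⌈K⌉+1) ≤ √e (2K+3)` never exceeds a constant times the quantum repetition factor `e^K`.
-/

namespace Summit.QuantumAdvantage.Dequantization.ReadoutNormLikelihood

open MeasureTheory ProbabilityTheory Real

/-- Lemma A170-1 (one mode, general real exponent `r`): the `r`-th moment under `N(0,p)` of the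
likelihood ratio `L_x = dN(x,p)/dN(0,p)`, `L_x(y) = exp (x y/p − x²/(2p))`, equals
`exp ((r² − r) x² / (2p))`. -/
theorem lrMoment (x r : ℝ) (p : NNReal) (hp : p ≠ 0) :
    ∫ y, rexp (r * (x * y / p - x ^ 2 / (2 * p))) ∂(gaussianReal 0 p)
      = rexp ((r ^ 2 - r) * x ^ 2 / (2 * p)) := by
  have hp' : (p : ℝ) ≠ 0 := by exact_mod_cast hp
  have hmgf := congrFun (mgf_id_gaussianReal (μ := 0) (v := p)) (r * x / p)
  simp only [mgf, id] at hmgf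
  have hsplit : ∀ y : ℝ, rexp (r * (x * y / p - x ^ 2 / (2 * p)))
      = rexp (-(r * x ^ 2 / (2 * p))) * rexp ((r * x / p) * y) := by
    intro y
    rw [← Real.exp_add]
    congr 1
    field_simp
    ring
  simp_rw [hsplit, integral_const_mul]
  rw [hmgf, ← Real.exp_add]
  congr 1
  field_simp
  ring

/-- The `r = 2` case: `∫ L_x² dN(0,p) = exp (x²/p)` — the per-mode factor of `‖ψ_out(x)‖²`
(equivalently `1 + χ²(N(x,p) ‖ N(0,p)) = exp (x²/p)`). -/
theorem readoutNormSq (x : ℝ) (p : NNReal) (hp : p ≠ 0) :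
    ∫ y, rexp (2 * (x * y / p - x ^ 2 / (2 * p))) ∂(gaussianReal 0 p) = rexp (x ^ 2 / p) := by
  rw [lrMoment x 2 p hp]
  congr 1
  have hp' : (p : ℝ) ≠ 0 := by exact_mod_cast hp
  field_simp
  ring

/-- Hölder exponent bookkeeping of Lemma A170-2: with `m − 1 ≥ K`, `m > 1`, the conjugate
exponent `r = m/(m−1)` satisfies `(r − 1) K / 2 = K / (2 (m − 1)) ≤ 1/2`. -/
theorem hoelderExponent (K m : ℝ) (hm : 1 < m) (hKm : K ≤ m - 1) :
    K / (2 * (m - 1)) ≤ 1 / 2 := by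
  have hpos : 0 < 2 * (m - 1) := by linarith
  rw [div_le_iff₀ hpos]
  linarith

/-- The classical variance factor is never worse than a constant times the quantum repetition
factor: `2K + 3 ≤ 3 e^K` for `K ≥ 0`. -/
theorem linear_le_exp (K : ℝ) (hK : 0 ≤ K) : 2 * K + 3 ≤ 3 * rexp K := by
  have h := Real.add_one_le_exp K
  linarith

end Summit.QuantumAdvantage.Dequantization.ReadoutNormLikelihood
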